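import Summits.Ventures.Crystal3D.Theorems.StickyWulffConstantNoReconstructionGainSupportedFilm
import HarnessLib

/-!
# Ball-by-ball certificates, III: every certificate only inspects the SUPPORTING contacts

HONEST FRAMING. Part of the venture `Summits/Ventures/Crystal3D` (cell `crystal3d-full`), helper
`--supports` the crux `NoReconstructionGain` (stmt-Ventures-19144, route
`route-Ventures-StickyWulffConstant`), line `adhesion`; continuation of `…SupportedFilm`.

Under the `ν`-height potential a film partner strictly `ν`-ABOVE a ball costs nothing in that ball's
count (T2), and deleting it from the configuration lowers the ball's degree and its number of higher
partners by the same amount.  Hence (T2) at `q` in `X` follows from (T2) at `q` in `X` minus the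
strictly higher film partners of `q` (`noGainIneq_of_erase_above`), and ALL four local certificates of
`…LocalFilm` / `…SupportedFilm` may ignore those partners:

* `noGainIneq_of_erase_above` — the supporting reduction;
* `supportedBarlowFilm_adhesion` (**the rung**, `R = 1`, `C = 0`; registered by name): above the cut,
  every film ball `q` has, among its SUPPORTING partners (substrate balls and film balls not strictly
  `ν`-higher than `q`) only: (a) balls on `≤ 6` lines through `q`; or (b) relatively basal Barlow balls
  (`x − q ∈ Λ₀ ∪ (Λ₀ ± w)`, with `ν₃² > 1/3`); or (c) relatively `w'`-Barlow balls (with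
  `(R_t ν)₃² > 1/3`); or (d) relatively two-family balls (both cone conditions) ⇒
  `#cross(P, X \ P) ≤ contactDeficiency (X \ P)`.

So Barlow grains of two families carrying ARBITRARY material on top — adatoms, ad-islands in any
stacking, overhangs — are certified as long as each decorating ball itself has few-line support.

WHAT THIS IS NOT: balls with `≥ 7` supporting contacts on `≥ 7` lines outside both Barlow frames;
films below the cut; rung F-C1 not moved.
-/

noncomputable section

namespace Summit.Ventures.Crystal3D.Theorems

open Summit.Ventures.Crystal3D Finset
open Literature.MathematicalPhysics.StatisticalMechanics (barlowPos barlowStacking fccStacking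
  barlowOffset constHagg haggLabel_const barlowPos_apply_zero barlowPos_apply_one barlowPos_apply_two
  orderedContacts contactDeficiency)
open scoped InnerProductSpace

/-! ### The supporting reduction -/

/-- **(T2) at `q` only depends on the supporting partners.**  If `A ⊆ X \ P` consists of partners of
`q` that are `Φ`-above `q` (and `q ∉ A`), then (T2) at `q` in `X \ A` implies (T2) at `q` in `X`. -/
theorem noGainIneq_of_erase_above (X P A : Finset (EuclideanSpace ℝ (Fin 3)))
    (q : EuclideanSpace ℝ (Fin 3)) (Φ : EuclideanSpace ℝ (Fin 3) → ℤ)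
    (hA : A ⊆ X \ P) (hAabove : ∀ x ∈ A, dist q x = 1 ∧ Φ q < Φ x)
    (h : ((((X \ A) \ P).filter fun x => dist q x = 1 ∧ Φ x < Φ q).card : ℤ)
        + ((P.filter fun p => dist q p = 1).card : ℤ)
      ≤ (12 - (((X \ A).filter fun x => dist q x = 1).card : ℤ))
        + ((((X \ A) \ P).filter fun x => dist q x = 1 ∧ Φ q < Φ x).card : ℤ)) :
    (((X \ P).filter fun x => dist q x = 1 ∧ Φ x < Φ q).card : ℤ)
        + ((P.filter fun p => dist q p = 1).card : ℤ)
      ≤ (12 - ((X.filter fun x => dist q x = 1).card : ℤ))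
        + (((X \ P).filter fun x => dist q x = 1 ∧ Φ q < Φ x).card : ℤ) := by
  classical
  have e1 : ((X \ A) \ P).filter (fun x => dist q x = 1 ∧ Φ x < Φ q) =
      (X \ P).filter (fun x => dist q x = 1 ∧ Φ x < Φ q) := by
    ext x
    simp only [mem_filter, mem_sdiff]
    constructor
    · rintro ⟨⟨⟨hxX, -⟩, hxP⟩, hd, hl⟩; exact ⟨⟨hxX, hxP⟩, hd, hl⟩
    · rintro ⟨⟨hxX, hxP⟩, hd, hl⟩
      exact ⟨⟨⟨hxX, fun hxA => lt_asymm hl (hAabove x hxA).2⟩, hxP⟩, hd, hl⟩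
  have e2 : (X \ A).filter (fun x => dist q x = 1) = X.filter (fun x => dist q x = 1) \ A := by
    ext x
    simp only [mem_filter, mem_sdiff]
    tauto
  have e3 : ((X \ A) \ P).filter (fun x => dist q x = 1 ∧ Φ q < Φ x) =
      (X \ P).filter (fun x => dist q x = 1 ∧ Φ q < Φ x) \ A := by
    ext x
    simp only [mem_filter, mem_sdiff]
    tauto
  have hA2 : A ⊆ X.filter (fun x => dist q x = 1) := fun x hx =>
    mem_filter.2 ⟨(mem_sdiff.1 (hA hx)).1, (hAabove x hx).1⟩
  have hA3 : A ⊆ (X \ P).filter (fun x => dist q x = 1 ∧ Φ q < Φ x) := fun x hx =>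
    mem_filter.2 ⟨hA hx, hAabove x hx⟩
  have c2 := card_sdiff_add_card_eq_card hA2
  have c3 := card_sdiff_add_card_eq_card hA3
  rw [e1, e2, e3] at h
  have c2' : (((X.filter fun x => dist q x = 1) \ A).card : ℤ) + (A.card : ℤ) =
      ((X.filter fun x => dist q x = 1).card : ℤ) := by exact_mod_cast c2
  have c3' : ((((X \ P).filter fun x => dist q x = 1 ∧ Φ q < Φ x) \ A).card : ℤ) + (A.card : ℤ) =
      (((X \ P).filter fun x => dist q x = 1 ∧ Φ q < Φ x).card : ℤ) := by exact_mod_cast c3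
  omega

/-! ### The rung -/

/-- **The atom from ball-by-ball certificates on the supporting contacts** (`R = 1`, `C = 0`;
registered by name on stmt-Ventures-19144). -/
theorem supportedBarlowFilm_adhesion :
    ∃ R C : ℝ, 1 ≤ R ∧ ∀ ν : EuclideanSpace ℝ (Fin 3), ‖ν‖ = 1 → ∀ ρ : ℝ, R ≤ ρ →
      ∀ X P : Finset (EuclideanSpace ℝ (Fin 3)),
      (∀ p ∈ X, ∀ q ∈ X, p ≠ q → 1 ≤ dist p q) → P ⊆ X →
      (∀ p, p ∈ P ↔ (p ∈ fccStacking 1 (Real.sqrt (2 / 3)) ∧ -(2 * R) ≤ ⟪p, ν⟫_ℝ ∧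
        ⟪p, ν⟫_ℝ ≤ -R ∧ ‖p‖ ^ 2 - ⟪p, ν⟫_ℝ ^ 2 ≤ ρ ^ 2)) →
      (∀ q ∈ X \ P, -R < ⟪q, ν⟫_ℝ) →
      (∀ q ∈ X \ P,
        (∃ W : Finset (EuclideanSpace ℝ (Fin 3)), W.card ≤ 6 ∧
            ∀ x ∈ X, dist q x = 1 → (x ∉ P ∧ ⟪q, ν⟫_ℝ < ⟪x, ν⟫_ℝ) ∨ ∃ w ∈ W, x = q + w ∨ x = q - w) ∨
        (1 / 3 < ν 2 ^ 2 ∧ ∀ x ∈ X, dist q x = 1 → (x ∉ P ∧ ⟪q, ν⟫_ℝ < ⟪x, ν⟫_ℝ) ∨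
            x - q ∈ fccStacking 1 (Real.sqrt (2 / 3)) ∨
            x - q - barlowOffset 1 ∈ fccStacking 1 (Real.sqrt (2 / 3)) ∨
            x - q + barlowOffset 1 ∈ fccStacking 1 (Real.sqrt (2 / 3))) ∨
        (1 / 3 < (2 * ⟪ν, barlowPos 1 (Real.sqrt (2 / 3)) constHagg 1 0 0⟫_ℝ * Real.sqrt (2 / 3) - ν 2) ^ 2 ∧
          ∀ x ∈ X, dist q x = 1 → (x ∉ P ∧ ⟪q, ν⟫_ℝ < ⟪x, ν⟫_ℝ) ∨
            x - q ∈ fccStacking 1 (Real.sqrt (2 / 3)) ∨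
            x - q - ((2 / 3 : ℝ) • barlowPos 1 (Real.sqrt (2 / 3)) constHagg 1 0 0 - barlowOffset 1) ∈
              fccStacking 1 (Real.sqrt (2 / 3)) ∨
            x - q + ((2 / 3 : ℝ) • barlowPos 1 (Real.sqrt (2 / 3)) constHagg 1 0 0 - barlowOffset 1) ∈
              fccStacking 1 (Real.sqrt (2 / 3))) ∨
        (1 / 3 < ν 2 ^ 2 ∧
          1 / 3 < (2 * ⟪ν, barlowPos 1 (Real.sqrt (2 / 3)) constHagg 1 0 0⟫_ℝ * Real.sqrt (2 / 3) - ν 2) ^ 2 ∧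
          ∀ x ∈ X, dist q x = 1 → (x ∉ P ∧ ⟪q, ν⟫_ℝ < ⟪x, ν⟫_ℝ) ∨
            x - q ∈ fccStacking 1 (Real.sqrt (2 / 3)) ∨
            x - q - barlowOffset 1 ∈ fccStacking 1 (Real.sqrt (2 / 3)) ∨
            x - q + barlowOffset 1 ∈ fccStacking 1 (Real.sqrt (2 / 3)) ∨
            x - q - ((2 / 3 : ℝ) • barlowPos 1 (Real.sqrt (2 / 3)) constHagg 1 0 0 - barlowOffset 1) ∈
              fccStacking 1 (Real.sqrt (2 / 3)) ∨
            x - q + ((2 / 3 : ℝ) • barlowPos 1 (Real.sqrt (2 / 3)) constHagg 1 0 0 - barlowOffset 1) ∈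
              fccStacking 1 (Real.sqrt (2 / 3)))) →
      ((((P ×ˢ (X \ P)).filter fun pq => dist pq.1 pq.2 = 1).card : ℕ) : ℝ) ≤
        contactDeficiency (X \ P) + C * ρ := by
  classical
  refine ⟨1, 0, le_rfl, fun ν hν ρ hρ X P hX hPX hP habove hcert => ?_⟩
  rw [zero_mul, add_zero]
  obtain ⟨Rt, hRt⟩ := exists_halfTurn_t
  obtain ⟨w, hw⟩ : ∃ w : EuclideanSpace ℝ (Fin 3), w = barlowOffset 1 := ⟨_, rfl⟩
  obtain ⟨w', hw'⟩ : ∃ w' : EuclideanSpace ℝ (Fin 3),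
      w' = (2 / 3 : ℝ) • barlowPos 1 (Real.sqrt (2 / 3)) constHagg 1 0 0 - barlowOffset 1 := ⟨_, rfl⟩
  rw [← hw', ← hw] at hcert
  have hRw : Rt w = w' := by rw [hw, hw', halfTurn_barlowOffset Rt hRt]
  have hRR : ∀ x, Rt (Rt x) = x := halfTurn_halfTurn Rt hRt
  have hRw' : Rt w' = w := by rw [← hRw, hRR]
  have hRmem : ∀ p, p ∈ fccStacking 1 (Real.sqrt (2 / 3)) → Rt p ∈ fccStacking 1 (Real.sqrt (2 / 3)) :=
    fun p hp => halfTurn_mem Rt hRt hp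
  have hR2 : (Rt ν) 2 = 2 * ⟪ν, barlowPos 1 (Real.sqrt (2 / 3)) constHagg 1 0 0⟫_ℝ * Real.sqrt (2 / 3) - ν 2 :=
    halfTurn_apply_two Rt hRt ν
  -- a linear function is midpoint-affine
  have hconv : ∀ q z : EuclideanSpace ℝ (Fin 3), 2 * ⟪q, ν⟫_ℝ ≤ ⟪q + z, ν⟫_ℝ + ⟪q - z, ν⟫_ℝ := by
    intro q z; rw [inner_add_left, inner_sub_left]; exact le_of_eq (by ring)
  -- relative `w'`-classes become relative basal classes under `R_t`
  have hRrel : ∀ d : EuclideanSpace ℝ (Fin 3),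
      (d ∈ fccStacking 1 (Real.sqrt (2 / 3)) ∨ d - w' ∈ fccStacking 1 (Real.sqrt (2 / 3)) ∨
        d + w' ∈ fccStacking 1 (Real.sqrt (2 / 3))) →
      (Rt d ∈ fccStacking 1 (Real.sqrt (2 / 3)) ∨ Rt d - w ∈ fccStacking 1 (Real.sqrt (2 / 3)) ∨
        Rt d + w ∈ fccStacking 1 (Real.sqrt (2 / 3))) := by
    intro d h
    rcases h with h | h | h
    · exact Or.inl (hRmem _ h)
    · refine Or.inr (Or.inl ?_); have := hRmem _ h; rwa [map_sub, hRw'] at this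
    · refine Or.inr (Or.inr ?_); have := hRmem _ h; rwa [map_add, hRw'] at this
  set f : EuclideanSpace ℝ (Fin 3) → ℝ := fun y => ⟪y, ν⟫_ℝ with hf
  set Φ : EuclideanSpace ℝ (Fin 3) → ℤ := fun x => (((X \ P).filter fun y => f y < f x).card : ℤ) with hΦ
  have hmain := cross_le_of_potential X P ∅ hX hPX (empty_subset _) Φ fun q hq => by
    rw [sdiff_empty] at hq
    have hlt : ∀ x ∈ X \ P, dist q x = 1 → (Φ x < Φ q ↔ ⟪x, ν⟫_ℝ < ⟪q, ν⟫_ℝ) := fun x hx _ => by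
      simp only [hΦ]; exact rank_lt_iff (X \ P) f x q hx
    have heq : ∀ x ∈ X \ P, dist q x = 1 → (Φ x = Φ q ↔ ⟪x, ν⟫_ℝ = ⟪q, ν⟫_ℝ) := fun x hx _ => by
      simp only [hΦ]; exact rank_eq_iff (X \ P) f x q hx hq
    have hplug : ∀ p ∈ P, dist q p = 1 → ⟪p, ν⟫_ℝ < ⟪q, ν⟫_ℝ := by
      intro p hp _
      obtain ⟨_, _, hp2, _⟩ := (hP p).1 hp
      exact lt_of_le_of_lt hp2 (habove q hq)
    -- the strictly higher film partners of `q` and the reduced configuration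
    obtain ⟨A, hAdef⟩ : ∃ S : Finset (EuclideanSpace ℝ (Fin 3)),
        S = (X \ P).filter fun x => dist q x = 1 ∧ ⟪q, ν⟫_ℝ < ⟪x, ν⟫_ℝ := ⟨_, rfl⟩
    have hA : A ⊆ X \ P := by rw [hAdef]; exact filter_subset _ _
    have hAabove : ∀ x ∈ A, dist q x = 1 ∧ Φ q < Φ x := by
      intro x hx
      rw [hAdef] at hx
      obtain ⟨hxQ, hd, hup⟩ := mem_filter.1 hx
      refine ⟨hd, ?_⟩
      simp only [hΦ]; exact (rank_lt_iff (X \ P) f q x hq).2 hup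
    have hXA : ∀ p ∈ X \ A, ∀ q ∈ X \ A, p ≠ q → 1 ≤ dist p q :=
      fun p hp q' hq' hne => hX p (mem_sdiff.1 hp).1 q' (mem_sdiff.1 hq').1 hne
    have hPXA : P ⊆ X \ A := fun p hp => mem_sdiff.2 ⟨hPX hp, fun hpA => (mem_sdiff.1 (hA hpA)).2 hp⟩
    have hsubA : (X \ A) \ P ⊆ X \ P := sdiff_subset_sdiff sdiff_subset le_rfl
    have hltA : ∀ x ∈ (X \ A) \ P, dist q x = 1 → (Φ x < Φ q ↔ ⟪x, ν⟫_ℝ < ⟪q, ν⟫_ℝ) :=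
      fun x hx hd => hlt x (hsubA hx) hd
    have heqA : ∀ x ∈ (X \ A) \ P, dist q x = 1 → (Φ x = Φ q ↔ ⟪x, ν⟫_ℝ = ⟪q, ν⟫_ℝ) :=
      fun x hx hd => heq x (hsubA hx) hd
    -- a supporting partner is not exempt
    have hsupp : ∀ x ∈ X \ A, dist q x = 1 → ¬ (x ∉ P ∧ ⟪q, ν⟫_ℝ < ⟪x, ν⟫_ℝ) := by
      intro x hx hd hex
      refine (mem_sdiff.1 hx).2 ?_
      rw [hAdef]
      exact mem_filter.2 ⟨mem_sdiff.2 ⟨(mem_sdiff.1 hx).1, hex.1⟩, hd, hex.2⟩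
    rcases hcert q hq with ⟨W, hWcard, hW⟩ | ⟨hν3, hrel⟩ | ⟨hν3b, hrel⟩ | ⟨hν3, hν3b, hrel⟩
    · -- (a) few lines: the antipodal lemma with `R` = non-above film partners
      obtain ⟨Rset, hRset⟩ : ∃ S : Finset (EuclideanSpace ℝ (Fin 3)),
          S = (X \ P).filter fun x => ⟪x, ν⟫_ℝ ≤ ⟪q, ν⟫_ℝ := ⟨_, rfl⟩
      have hRsub : Rset ⊆ X \ P := by rw [hRset]; exact filter_subset _ _
      refine antipodal_noGainPotential_of_above X P Rset hPX hRsub q Φ (fun y => ⟪y, ν⟫_ℝ)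
        (fun x hx hd => ?_) (fun x hx hd => hlt x (hRsub hx) hd) (fun x hx hd => heq x (hRsub hx) hd)
        hplug (hconv q) W hWcard (fun x hx hd hxR => ?_)
      swap
      · -- a supporting partner is on a line of `W`; a strictly higher film partner is exempt
        rcases hW x hx hd with ⟨hxP, hup⟩ | h
        · exfalso
          refine hxR (mem_sdiff.2 ⟨mem_sdiff.2 ⟨hx, hxP⟩, fun hxRset => ?_⟩)
          rw [hRset] at hxRset
          exact (not_le.2 hup) (mem_filter.1 hxRset).2
        · exact h
      have hxQ : x ∈ X \ P := (mem_sdiff.1 hx).1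
      have hnot : ¬ ⟪x, ν⟫_ℝ ≤ ⟪q, ν⟫_ℝ := fun hle =>
        (mem_sdiff.1 hx).2 (by rw [hRset]; exact mem_filter.2 ⟨hxQ, hle⟩)
      have h1 : ¬ Φ x < Φ q := fun hl => hnot ((hlt x hxQ hd).1 hl).le
      have h2 : ¬ Φ x = Φ q := fun he => hnot ((heq x hxQ hd).1 he).le
      exact lt_of_le_of_ne (not_lt.1 h1) (Ne.symm h2)
    · -- (b) locally basal Barlow on the supporting partners
      refine noGainIneq_of_erase_above X P A q Φ hA hAabove ?_
      refine basal_noGainPotential (X \ A) P hXA hPXA q Φ ν hν hν3 hltA heqA hplug fun x hx hd => ?_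
      have h := (hrel x (mem_sdiff.1 hx).1 hd).resolve_left (hsupp x hx hd)
      rw [hw] at h
      exact relBasal_shape h hd
    · -- (c) locally Barlow of the second family on the supporting partners: reduce, transport
      have hν3' : 1 / 3 < (Rt ν) 2 ^ 2 := by rw [hR2]; exact hν3b
      have hgi : Isometry (Rt : EuclideanSpace ℝ (Fin 3) → EuclideanSpace ℝ (Fin 3)) := Rt.isometry
      refine noGainIneq_of_erase_above X P A q Φ hA hAabove ?_
      refine noGainIneq_of_isometry Rt (X \ A) P q Φ ?_
      have hXp : ∀ p ∈ (X \ A).image Rt, ∀ q ∈ (X \ A).image Rt, p ≠ q → 1 ≤ dist p q := by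
        intro p hp q' hq' hpq
        obtain ⟨p₀, hp₀, rfl⟩ := mem_image.1 hp
        obtain ⟨q₀, hq₀, rfl⟩ := mem_image.1 hq'
        rw [hgi.dist_eq]
        exact hXA p₀ hp₀ q₀ hq₀ fun e => hpq (by rw [e])
      have hsd : (X \ A).image Rt \ P.image Rt = ((X \ A) \ P).image Rt :=
        (image_sdiff (X \ A) P Rt.injective).symm
      refine basal_noGainPotential ((X \ A).image Rt) (P.image Rt) hXp (image_subset_image hPXA) (Rt q)
        (fun y => Φ (Rt.symm y)) (Rt ν) (by rw [LinearIsometryEquiv.norm_map, hν]) hν3'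
        (fun y hy hd => ?_) (fun y hy hd => ?_) (fun p hp hd => ?_) (fun y hy hd => ?_)
      · rw [hsd] at hy
        obtain ⟨x, hx, rfl⟩ := mem_image.1 hy
        rw [Rt.symm_apply_apply, Rt.symm_apply_apply, LinearIsometryEquiv.inner_map_map,
          LinearIsometryEquiv.inner_map_map]
        exact hltA x hx (by rw [← Rt.dist_map]; exact hd)
      · rw [hsd] at hy
        obtain ⟨x, hx, rfl⟩ := mem_image.1 hy
        rw [Rt.symm_apply_apply, Rt.symm_apply_apply, LinearIsometryEquiv.inner_map_map,
          LinearIsometryEquiv.inner_map_map]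
        exact heqA x hx (by rw [← Rt.dist_map]; exact hd)
      · obtain ⟨p₀, hp₀, rfl⟩ := mem_image.1 hp
        rw [LinearIsometryEquiv.inner_map_map, LinearIsometryEquiv.inner_map_map]
        exact hplug p₀ hp₀ (by rw [← Rt.dist_map]; exact hd)
      · obtain ⟨x, hx, rfl⟩ := mem_image.1 hy
        have hd' : dist q x = 1 := by rw [← Rt.dist_map]; exact hd
        have h := hRrel (x - q) ((hrel x (mem_sdiff.1 hx).1 hd').resolve_left (hsupp x hx hd'))
        rw [map_sub, hw] at h
        exact relBasal_shape h hd
    · -- (d) locally two-family on the supporting partners: the lattice-ball count after reduction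
      have hν3' : 1 / 3 < (Rt ν) 2 ^ 2 := by rw [hR2]; exact hν3b
      refine noGainIneq_of_erase_above X P A q Φ hA hAabove ?_
      refine twoFamily_lattice_noGainPotential (X \ A) P hXA hPXA q Φ ν hν hν3 Rt hRt hν3' hltA heqA
        hplug fun x hx hd => ?_
      rw [← hw]
      rcases (hrel x (mem_sdiff.1 hx).1 hd).resolve_left (hsupp x hx hd) with h | h | h | h | h
      · exact Or.inl h
      · exact Or.inr (Or.inl h)
      · exact Or.inr (Or.inr (Or.inl h))
      · refine Or.inr (Or.inr (Or.inr (Or.inl ?_)))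
        have := hRmem _ h; rwa [map_sub, hRw'] at this
      · refine Or.inr (Or.inr (Or.inr (Or.inr ?_)))
        have := hRmem _ h; rwa [map_add, hRw'] at this
  simpa using hmain

end Summit.Ventures.Crystal3D.Theorems

end
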